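import Summits.AnomalousDissipation.AnomalousDissipation.Theorems.SolenoidalFractalHomogenisationRealisedQuasiStaticCellLawSlotWindows
import HarnessLib

/-!
# K2R `RealisedQuasiStaticCellLaw`, line `floquet-bloch`: locating the good windows of a slot in absolute time
# (helper towards `stub_lowSectorDecay` / `stub_upperSome`; `--supports stmt-AnomalousDissipation-20446`)

Summits-side helper file (everything proved; no definitions, no named facts). Period arithmetic for a lattice word `W`
with period `P`: for `t = p·P + r`, `0 ≤ r < P`, the replayed phase is `fract(t/P)·P = r` (`fract_period_mul`); hence on
the absolute time window `[p·P + start j + ρτ_j/2, p·P + start j + τ_j − ρτ_j/2]` of the `p`-th period the phase lies in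
slot `j` and the trapezoid envelope is at least `1/2` (`slot_window_of_middle`) — the windows on which the ladder functional
is applied in the far-sector bookkeeping (STUB-PLAN `stub_lowSectorDecay` §3.5), to be combined with `cell_stretch` for the
quasi-statically replayed stretched words.
-/

set_option linter.dupNamespace false

noncomputable section

namespace Summit.AnomalousDissipation.AnomalousDissipation.Theorems.SolenoidalFractalHomogenisation.RealisedQuasiStaticCellLaw

open Set
open Literature.Analysis Literature.Analysis.FunctionSpaces Literature.Analysis.FluidPDE Literature.Analysis.FluidPDE.LatticeShear
open Summit.AnomalousDissipation.AnomalousDissipation.Theorems.SolenoidalFractalHomogenisation.PermissibleCarrier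

variable {k₀ : ℕ}

/-- **Period arithmetic**: `fract((p·P + r)/P)·P = r` for `0 ≤ r < P`, `p ∈ ℤ`. -/
theorem fract_period_mul {P : ℝ} (hP : 0 < P) (p : ℤ) {r : ℝ} (hr0 : 0 ≤ r) (hrP : r < P) :
    Int.fract ((p * P + r) / P) * P = r := by
  have e : (p * P + r) / P = (p : ℝ) + r / P := by field_simp
  rw [e, Int.fract_intCast_add, Int.fract_eq_self.2 ⟨div_nonneg hr0 hP.le, (div_lt_one hP).2 hrP⟩,
    div_mul_cancel₀ r hP.ne']

/-- **The good window of slot `j` in the `p`-th period**: for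
`t ∈ [p·P + start j + ρτ_j/2, p·P + start j + τ_j − ρτ_j/2]`, the replayed phase `fract(t/P)·P` lies in slot `j` and the
envelope of slot `j` is at least `1/2` there. -/
theorem slot_window_of_middle (W : LatticeWord k₀) (j : Fin k₀) (p : ℤ) {t : ℝ}
    (ht : t ∈ Icc (p * W.period + W.start j + W.ramp * (W.phase j).τ / 2)
      (p * W.period + W.start j + (W.phase j).τ - W.ramp * (W.phase j).τ / 2)) :
    Int.fract (t / W.period) * W.period ∈ Icc (W.start j) (W.start j + (W.phase j).τ) ∧
      1 / 2 ≤ LatticeWord.trapezoid (W.start j) (W.phase j).τ W.ramp (Int.fract (t / W.period) * W.period) := by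
  have hP := period_pos W
  have hρτ : 0 < W.ramp * (W.phase j).τ := mul_pos W.ramp_pos (W.phase j).τ_pos
  have hs0 := start_nonneg W j
  have hsP := start_add_tau_le_period W j
  set r : ℝ := t - p * W.period with hr
  have ht' : t = p * W.period + r := by rw [hr]; ring
  have hr0 : 0 ≤ r := by rw [hr]; linarith [ht.1]
  have hrP : r < W.period := by rw [hr]; linarith [ht.2]
  have hphase : Int.fract (t / W.period) * W.period = r := by rw [ht']; exact fract_period_mul hP p hr0 hrP
  rw [hphase]
  refine ⟨⟨by rw [hr]; linarith [ht.1], by rw [hr]; linarith [ht.2]⟩, ?_⟩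
  exact half_le_trapezoid hρτ ⟨by rw [hr]; linarith [ht.1], by rw [hr]; linarith [ht.2]⟩

/-- The good window of slot `j` in the `p`-th period is non-empty (indeed of length `τ_j(1 − ρ) > 0`). -/
theorem slot_window_nonempty (W : LatticeWord k₀) (j : Fin k₀) (p : ℤ) :
    p * W.period + W.start j + W.ramp * (W.phase j).τ / 2 <
      p * W.period + W.start j + (W.phase j).τ - W.ramp * (W.phase j).τ / 2 := by
  have hτ := (W.phase j).τ_pos
  have hρ := W.ramp_le
  have hρ0 := W.ramp_pos
  nlinarith

end Summit.AnomalousDissipation.AnomalousDissipation.Theorems.SolenoidalFractalHomogenisation.RealisedQuasiStaticCellLaw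

end
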